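import Mathlib
import Literature.Analysis.PDE.InverseSquareChannelIdentity
import Literature.Analysis.PDE.InverseSquareChannelIdentityReversed
import Literature.Analysis.PDE.InverseSquareRegularWave
import HarnessLib

/-!
# The exterior-energy identity with apex at (or inside) the centre for exact inverse-square waves

Analysis/PDE support file (everything proved, no definitions). **Statement** (1-D form, in the
Regge–Wheeler variable `ψ = r^{(d−1)/2}u`, of the odd-dimensional exterior-energy identity
`Σ_± lim_{t→±∞} ∫_{|x|>|t|} |∇_{t,x}u|² = ‖(u₀,u₁)‖²_E` of Duyckaerts–Kenig–Merle for RADIAL data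
supported off a ball; Kenig–Lawrie–Liu–Schlag, Adv. Math. 285 (2015) §2; Côte–Laurent, Rev. Mat.
Iberoam. 40 (2024)). Fix `n ≥ 1`, a smooth `ι = 1/x` on `[½,∞)`, data `h ∈ C²`, `g ∈ C¹`
supported in `[R₁, B]`, `1 < R₁ ≤ B`. The regular exact wave `φ` of
`φ_tt − φ_xx + n(n+1)ι²φ = 0` (`x > ½`) with these data (`InverseSquareRegularWave.lean`) has, for
EVERY apex `a ≤ 0` (cone tip at or inside the centre of the potential), genuine forward/backward
channel limits

  `L⁺(a) = lim_{t→+∞} ∫_{x > a+t} e[φ](t)`,  `L⁻(a) = lim_{t→−∞} ∫_{x > a−t} e[φ](t)`,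

and they dominate the FULL energy of the data with constant one, uniformly in `n`:

  `∫_{R₁}^B h′² + n(n+1)ι²h² + g² ≤ L⁺(a) + L⁻(a)`   (`inverseSquare_exteriorEnergy_ge`)

(in fact `L⁺(a) + L⁻(a) = E + 2∫_a^{|a|}(F⁽ⁿ⁺¹⁾)²`; with apex `a > 0` to the right of the centre
the glancing part `2∫_{−a}^{a}(F⁽ⁿ⁺¹⁾)²` is lost instead, and that loss is NOT uniform in `n`).
Proof: the energy identity `E = 2∫_0^B (F⁽ⁿ⁺¹⁾)² + 2∫_0^B (G⁽ⁿ⁺¹⁾)²` of the regular wave (exact ladder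
isometry across the gap), the channel-limit identities at edge `1` applied to the time-shifted
waves `Φ(t ± (1−a), ·)` (`InverseSquareChannelIdentity(Reversed).lean`), and monotonicity in `a`.
This is the parity-sensitive, `ℓ`-uniform far-side input of route PhotonSphereChannels, item
`WindowedShellChannels` (stmt-FinalStateConjecture-14085): for Regge–Wheeler `n = ℓ`, i.e.
`ν = ℓ + ½` half-integer (odd `d = 2ℓ + 3`).
-/

noncomputable section

namespace Literature.Analysis.PDE

open Set Filter Topology MeasureTheory Literature.Analysis.ODE

variable {ι : ℝ → ℝ}

/-- **Exterior-energy identity with apex at or inside the centre** (inequality form, constant one,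
uniform in `n`). See the module docstring. [cite: KenigEtAl2015, Theorem 5 and §2 (odd d)] -/
theorem inverseSquare_exteriorEnergy_ge (hι : ContDiff ℝ (⊤ : ℕ∞) ι)
    (hιeq : ∀ x : ℝ, 1 / 2 ≤ x → ι x = x⁻¹) {I : ℝ → ℝ} (hI : ContDiff ℝ (⊤ : ℕ∞) I)
    (hI' : ∀ x, HasDerivAt I (ι x) x) {n : ℕ} (hn : 1 ≤ n) {h g : ℝ → ℝ}
    (hh : ContDiff ℝ 2 h) (hg : ContDiff ℝ 1 g) {R₁ B : ℝ}
    (hR₁ : 1 < R₁) (hR₁B : R₁ ≤ B) (hh0 : ∀ x, x ≤ R₁ → h x = 0) (hg0 : ∀ x, x ≤ R₁ → g x = 0)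
    (hhB : ∀ x, B ≤ x → h x = 0) (hgB : ∀ x, B ≤ x → g x = 0) :
    ∃ φ : ℝ → ℝ → ℝ, ContDiff ℝ 2 (Function.uncurry φ) ∧
      (∀ t, ∀ x ∈ Ioi (1 / 2 : ℝ), iteratedDeriv 2 (fun τ => φ τ x) t
        = iteratedDeriv 2 (φ t) x - n * (n + 1) * ι x ^ 2 * φ t x) ∧
      (∀ x, 1 / 2 < x → φ 0 x = h x) ∧ (∀ x, 1 / 2 < x → deriv (fun τ => φ τ x) 0 = g x) ∧
      (∀ t x, 1 / 2 < x → x + |t| < R₁ → φ t x = 0) ∧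
      ∀ a : ℝ, a ≤ 0 → ∃ Lp Lm : ℝ,
        Tendsto (fun t => ∫ x in Ioi (a + t), (deriv (fun τ => φ τ x) t ^ 2 + deriv (φ t) x ^ 2
          + (n : ℝ) * (n + 1) * ι x ^ 2 * φ t x ^ 2)) atTop (𝓝 Lp) ∧
        Tendsto (fun t => ∫ x in Ioi (a - t), (deriv (fun τ => φ τ x) t ^ 2 + deriv (φ t) x ^ 2
          + (n : ℝ) * (n + 1) * ι x ^ 2 * φ t x ^ 2)) atBot (𝓝 Lm) ∧
        (∫ x in R₁..B, deriv h x ^ 2 + n * (n + 1) * ι x ^ 2 * h x ^ 2 + g x ^ 2) ≤ Lp + Lm := by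
  obtain ⟨Φ, F, G, -, hFC, hGC, hrep, hFB, hGB, hφC2, hφsol, hdat0, hdat1, hsupp, hE⟩ :=
    exists_regularWave hι hιeq hI hI' hn hh hg hR₁ hR₁B hh0 hg0 hhB hgB
  set φ : ℝ → ℝ → ℝ := fun t => ladder ι n (Φ t) with hφ
  refine ⟨φ, hφC2, hφsol, hdat0, hdat1, hsupp, fun a ha => ?_⟩
  set E : ℝ → ℝ → ℝ := fun s x => deriv (fun τ => φ τ x) s ^ 2 + deriv (φ s) x ^ 2
    + (n : ℝ) * (n + 1) * ι x ^ 2 * φ s x ^ 2 with hEdef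
  set T : ℝ := 1 - a with hT
  have hT1 : 1 ≤ T := by rw [hT]; linarith
  have hB1 : 1 ≤ B + T := by linarith
  -- forward: the wave shifted by `T`
  set Fp : ℝ → ℝ := fun y => F (y - T) with hFp
  set Gp : ℝ → ℝ := fun y => G (y + T) with hGp
  have hFpC : ContDiff ℝ ((n + 2 : ℕ) : ℕ∞) Fp := hFC.comp (contDiff_id.sub contDiff_const)
  have hGpC : ContDiff ℝ ((n + 2 : ℕ) : ℕ∞) Gp := hGC.comp (contDiff_id.add contDiff_const)
  have hFpB : ∀ y, B + T ≤ y → Fp y = Fp (B + T) := by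
    intro y hy
    show F (y - T) = F (B + T - T)
    rw [hFB (y - T) (by linarith), add_sub_cancel_right]
  have hGpB : ∀ y, B + T ≤ y → Gp y = -Fp (B + T) := by
    intro y hy
    show G (y + T) = -F (B + T - T)
    rw [hGB (y + T) (by linarith), add_sub_cancel_right]
  have hΦp : ∀ t x, (fun t x => Φ (t + T) x) t x = Fp (x - t) + Gp (x + t) := by
    intro t x
    show Φ (t + T) x = F (x - t - T) + G (x + t + T)
    rw [hrep]; congr 1 <;> congr 1 <;> ring
  have hlimP := inverseSquare_channel_limit_atTop hι hιeq n hFpC hGpC le_rfl hB1 hFpB hGpB hΦp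
  -- backward: the wave shifted by `−T`
  set Fm : ℝ → ℝ := fun y => F (y + T) with hFm
  set Gm : ℝ → ℝ := fun y => G (y - T) with hGm
  have hFmC : ContDiff ℝ ((n + 2 : ℕ) : ℕ∞) Fm := hFC.comp (contDiff_id.add contDiff_const)
  have hGmC : ContDiff ℝ ((n + 2 : ℕ) : ℕ∞) Gm := hGC.comp (contDiff_id.sub contDiff_const)
  have hFmB : ∀ y, B + T ≤ y → Fm y = Fm (B + T) := by
    intro y hy
    show F (y + T) = F (B + T + T)
    rw [hFB (y + T) (by linarith), hFB (B + T + T) (by linarith)]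
  have hGmB : ∀ y, B + T ≤ y → Gm y = -Fm (B + T) := by
    intro y hy
    show G (y - T) = -F (B + T + T)
    rw [hGB (y - T) (by linarith), hFB (B + T + T) (by linarith)]
  have hΦm : ∀ t x, (fun t x => Φ (t - T) x) t x = Fm (x - t) + Gm (x + t) := by
    intro t x
    show Φ (t - T) x = F (x - t + T) + G (x + t - T)
    rw [hrep]; congr 1 <;> congr 1 <;> ring
  have hlimM := inverseSquare_channel_limit_atBot hι hιeq n hFmC hGmC le_rfl hB1 hFmB hGmB hΦm
  -- identify the shifted integrals
  set K : ℝ → ℝ := fun s => ∫ x in Ioi (a + s), E s x with hK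
  set K' : ℝ → ℝ := fun s => ∫ x in Ioi (a - s), E s x with hK'
  have hfunP : (fun t => ∫ x in Ioi (1 + t), (deriv (fun τ => ladder ι n ((fun t x => Φ (t + T) x) τ) x) t ^ 2
      + deriv (ladder ι n ((fun t x => Φ (t + T) x) t)) x ^ 2
      + (n : ℝ) * (n + 1) * ι x ^ 2 * ladder ι n ((fun t x => Φ (t + T) x) t) x ^ 2))
      = fun t => K (t + T) := by
    funext t
    have hset : Ioi (1 + t) = Ioi (a + (t + T)) := by rw [hT]; congr 1; ring
    rw [hK]
    simp only [hset]
    refine setIntegral_congr_fun measurableSet_Ioi fun x _ => ?_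
    have hd : deriv (fun τ => ladder ι n ((fun t x => Φ (t + T) x) τ) x) t
        = deriv (fun τ => φ τ x) (t + T) := by
      show deriv (fun τ => φ (τ + T) x) t = deriv (fun τ => φ τ x) (t + T)
      exact deriv_comp_add_const (fun τ => φ τ x) T t
    show deriv (fun τ => ladder ι n ((fun t x => Φ (t + T) x) τ) x) t ^ 2
      + deriv (φ (t + T)) x ^ 2 + (n : ℝ) * (n + 1) * ι x ^ 2 * φ (t + T) x ^ 2 = E (t + T) x
    rw [hd]
  have hfunM : (fun t => ∫ x in Ioi (1 - t), (deriv (fun τ => ladder ι n ((fun t x => Φ (t - T) x) τ) x) t ^ 2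
      + deriv (ladder ι n ((fun t x => Φ (t - T) x) t)) x ^ 2
      + (n : ℝ) * (n + 1) * ι x ^ 2 * ladder ι n ((fun t x => Φ (t - T) x) t) x ^ 2))
      = fun t => K' (t - T) := by
    funext t
    have hset : Ioi (1 - t) = Ioi (a - (t - T)) := by rw [hT]; congr 1; ring
    rw [hK']
    simp only [hset]
    refine setIntegral_congr_fun measurableSet_Ioi fun x _ => ?_
    have hd : deriv (fun τ => ladder ι n ((fun t x => Φ (t - T) x) τ) x) t
        = deriv (fun τ => φ τ x) (t - T) := by
      show deriv (fun τ => φ (τ - T) x) t = deriv (fun τ => φ τ x) (t - T)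
      exact deriv_comp_sub_const (fun τ => φ τ x) T t
    show deriv (fun τ => ladder ι n ((fun t x => Φ (t - T) x) τ) x) t ^ 2
      + deriv (φ (t - T)) x ^ 2 + (n : ℝ) * (n + 1) * ι x ^ 2 * φ (t - T) x ^ 2 = E (t - T) x
    rw [hd]
  rw [hfunP] at hlimP
  rw [hfunM] at hlimM
  -- undo the shifts in the limits
  have hP : Tendsto K atTop (𝓝 (2 * ∫ y in (1 : ℝ)..(B + T), iteratedDeriv (n + 1) Fp y ^ 2)) := by
    have h2 := hlimP.comp (tendsto_atTop_add_const_right atTop (-T) tendsto_id)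
    have h3 : (fun t => K (t + T)) ∘ (fun s => id s + -T) = K := by
      funext s; simp [Function.comp]
    rwa [h3] at h2
  have hM : Tendsto K' atBot (𝓝 (2 * ∫ y in (1 : ℝ)..(B + T), iteratedDeriv (n + 1) Gm y ^ 2)) := by
    have h2 := hlimM.comp (tendsto_atBot_add_const_right atBot T tendsto_id)
    have h3 : (fun t => K' (t - T)) ∘ (fun s => id s + T) = K' := by
      funext s; simp [Function.comp]
    rwa [h3] at h2
  -- the limiting values
  have hvalP : (∫ y in (1 : ℝ)..(B + T), iteratedDeriv (n + 1) Fp y ^ 2)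
      = ∫ y in a..B, iteratedDeriv (n + 1) F y ^ 2 := by
    have e : iteratedDeriv (n + 1) Fp = fun y => iteratedDeriv (n + 1) F (y - T) :=
      iteratedDeriv_comp_sub_const (n := n + 1) (f := F) (s := T)
    rw [e]
    rw [intervalIntegral.integral_comp_sub_right (fun y => iteratedDeriv (n + 1) F y ^ 2) T]
    congr 1 <;> rw [hT] <;> ring
  have hvalM : (∫ y in (1 : ℝ)..(B + T), iteratedDeriv (n + 1) Gm y ^ 2)
      = ∫ y in a..B, iteratedDeriv (n + 1) G y ^ 2 := by
    have e : iteratedDeriv (n + 1) Gm = fun y => iteratedDeriv (n + 1) G (y - T) :=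
      iteratedDeriv_comp_sub_const (n := n + 1) (f := G) (s := T)
    rw [e]
    rw [intervalIntegral.integral_comp_sub_right (fun y => iteratedDeriv (n + 1) G y ^ 2) T]
    congr 1 <;> rw [hT] <;> ring
  rw [hvalP] at hP
  rw [hvalM] at hM
  refine ⟨_, _, hP, hM, ?_⟩
  -- monotonicity in the apex: `∫_a^B ≥ ∫_0^B` for `a ≤ 0`
  have cF : Continuous fun y => iteratedDeriv (n + 1) F y ^ 2 :=
    (hFC.continuous_iteratedDeriv _ (by exact_mod_cast Nat.le_succ _)).pow 2
  have cG : Continuous fun y => iteratedDeriv (n + 1) G y ^ 2 :=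
    (hGC.continuous_iteratedDeriv _ (by exact_mod_cast Nat.le_succ _)).pow 2
  have hmonoF : (∫ y in (0 : ℝ)..B, iteratedDeriv (n + 1) F y ^ 2)
      ≤ ∫ y in a..B, iteratedDeriv (n + 1) F y ^ 2 := by
    rw [← intervalIntegral.integral_add_adjacent_intervals (cF.intervalIntegrable a 0)
      (cF.intervalIntegrable 0 B)]
    have : 0 ≤ ∫ y in a..(0 : ℝ), iteratedDeriv (n + 1) F y ^ 2 :=
      intervalIntegral.integral_nonneg ha fun y _ => sq_nonneg _
    linarith
  have hmonoG : (∫ y in (0 : ℝ)..B, iteratedDeriv (n + 1) G y ^ 2)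
      ≤ ∫ y in a..B, iteratedDeriv (n + 1) G y ^ 2 := by
    rw [← intervalIntegral.integral_add_adjacent_intervals (cG.intervalIntegrable a 0)
      (cG.intervalIntegrable 0 B)]
    have : 0 ≤ ∫ y in a..(0 : ℝ), iteratedDeriv (n + 1) G y ^ 2 :=
      intervalIntegral.integral_nonneg ha fun y _ => sq_nonneg _
    linarith
  rw [hE]
  linarith

end Literature.Analysis.PDE
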